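import Summits.CriticalPhenomena.CardyFormulaZ2.Theorems.CardyMagicRigidityNestingRigidityNeckCoveringAChainT
import Summits.CriticalPhenomena.CardyFormulaZ2.Theorems.CardyMagicRigidityNestingRigidityNeckCoveringBDistinct
import Summits.CriticalPhenomena.CardyFormulaZ2.Theorems.CardyMagicRigidityNestingRigidityNeckHookStarTarget
import Summits.CriticalPhenomena.CardyFormulaZ2.Theorems.CardyMagicRigidityNestingRigidityTPinchPositive
import HarnessLib

/-!
# Crux `NestingRigidity`, line `pinch-resampling` (v4), stub S11: the error of `Hook*` on `𝕋` is covered by the two node events, and S11 from their absolute bounds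

Crux `Summit.CriticalPhenomena.CardyFormulaZ2.Theses.CardyMagicRigidity.NestingRigidity` (stmt-CriticalPhenomena-4835),
line `pinch-resampling` v4, stub S11 `stub_neckHookupCoarseT : NeckHookupCoarseT`.  Worker W6c, wave 6: the site-`𝕋` twin of
`…NeckZ2ErrorCover` / `…NeckZ2ErrorCoverChain` (stub S12, p166496), i.e. the reduction of the SUMMATION hypothesis of
`hookStarApproxT_of_absolute tPinchPositive_holds` (`…NeckHookStarTarget`) to absolute bounds on two pure percolation
events:

* §1 `TNodeEventChainA ℓ lam s x o` — the NECKLACE node event of the `𝔄`-error (conclusion of `tCovering_A_chain`,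
  `…NeckCoveringAChainT`: a needed family of virtual edges with node property, three-edge exclusion and the necklace of
  pairwise distinct open clusters), `TNodeEventB lam s x` — the node event of the `𝔅`-error (conclusion of
  `covering_B_distinct`, `…NeckCoveringBDistinct`: a blocking family of small blobs, distinct members in DISTINCT blobs, every
  blob adjacent to both sides, node property); `error_subset_tNodeEvents`:
  `(THookStar ∖ THook) ∪ (THook ∖ THookBig) ⊆ TNodeEventChainA ∪ TNodeEventB` for `1 ≤ ℓ`, `1 ≤ lam`, `lam + 1 ≤ s`.
* §2 `TNodeAbsBoundChainA`, `TNodeAbsBoundB`, `TSmallBlobIrrelevanceT : Prop` (NOT asserted) — the absolute bounds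
  (`TNodeAbsBoundB → TSmallBlobIrrelevanceT`); `tErrorAbs_of_chainA_of_irrelevance` / `tErrorAbs_of_nodeBounds` — they give
  the summation hypothesis verbatim; `neckHookupCoarseT_of_chainA_of_irrelevance` and `neckHookupCoarseT_of_nodeInputs :
  TNodeAbsBoundChainA → TNodeAbsBoundB → NeckHookupCoarseT` (registered anchor; positivity (I0) is the tree theorem
  `tPinchPositive_holds`, p165760).

## Status of the two bounds (what blocks S11 after wave 6)

**`TNodeAbsBoundChainA` (𝔄).**  Same shape and same plan as `ZNodeAbsBoundChainA` (module docstring of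
`…NeckZ2NodeReimerSpatial`, p168307; bookkeeping being landed by worker W6a: `…GapHierarchy`), CONDITIONAL on (I4T)
`FourArmTwoClustersBoundT` (`…NeckFourArmInputsT`; from the named fact `SmirnovWerner2001_fourArm_scalingLimit` by
`fourArmTwoClustersBoundT_of_scalingLimit`).  `𝕋` primitives in the tree: (N) `real_biInter_tFourArmTwoClusters_le_prod_rpow`
(p162284), recentring and nets `real_exists_tFourArm_innerLayer_le` (p166309), (B) `real_distinctClustersT_arms_le_prod` and
`real_forall_bigBlobT_near_le_pow` (p167956); the structure (this line of files).  NOT in the tree on `𝕋`: the Reimer glue (R)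
`real_fourArm_and_arms_le` of `…NeckZ2NodeReimer(Spatial)` (site version: `SiteReimer`), and the summation itself.

**`TNodeAbsBoundB` (𝔅) — the necklace question (analysis of worker W6c; NEGATIVE for both designs of the brief).**  Write
`ρ_Q = G_Q/(Δ_Q + lam)` for a node `Q` of the single-linkage hierarchy of the family `F` on the inner layer (diameter `Δ_Q`, gap
`G_Q`).  A union bound over families enumerates member positions; the gap-entropy lemma (worker W6a, `…GapHierarchy`) charges
every node `Q ≠ root` with `log⁺ρ_Q + log 3` nats, and the only certificate of `TNodeEventB` — (I4T) on the `F`-free annulus of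
`Q` — repays `(1+ε) log ρ_Q - log C`, so each node contributes a FACTOR `3ρ_Q · min(1, Cρ_Q^{-(1+ε)}) ≤ K := 3C^{1/(1+ε)}`,
small (`3Cρ_Q^{-ε}`) only for `ρ_Q` large.  Hierarchies all of whose LEAVES have `ρ ≥ M` are summable once `M^{ε} > 3CK`
(a leaf pays for itself and for one internal node; `#internal < #leaves`), with total `O((lam/s)^{ε} log(s/lam))` from the
root.  But a run of `m` members at consecutive spacing `< M·lam` contributes `K^{≍ m}` against a certified cost `1`, and this
is not an artefact: (i) "dense run = ONE four-arm node" (no internal enumeration) still pays the length entropy and the factor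
`K` of the run's own node, and runs of bounded length separated by gaps in `(ρ*, M)·lam` ("dashed necklaces") re-create the
deficit at the next level; (ii) a necklace bound `P(run of m two-sided members in a window) ≤ C q^m` closes the books only if
`q < K^{-2}` — an EXPLICIT rate against explicit entropy constants, whereas the tree's RSW and (I4T) constants are
qualitative; with `q = q(M)` from per-member RSW patterns the requirement is circular (`M ≥ K^{E₀/ε}` for runs shorter than
`E₀`, `E₀ ≳ M` for longer ones).  Moreover the natural RSW certificate of any `q < 1` fails: an open circuit around a member
passes through the neighbouring members' blobs, which `avoidSet F` deletes, and heuristically every period of a dense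
two-sided run is an RSW pattern of probability bounded away from `0` and `1` at scale `lam`.  CONCLUSION: no union bound over
`TNodeEventB` (nor over any enumerated family) certifies `TNodeAbsBoundB` from the tree's inputs; the `𝔅`-half of S11 needs a
certificate for DENSE TWO-SIDED CONTACT RUNS that is not a product of four-arm events — equivalently the honest input is the
small-blob irrelevance `TSmallBlobIrrelevanceT` below (`P(TPinch ∩ THook ∖ THookBig) → 0`), which is (close to) the content
of the stub itself: `NeckHookupCoarseT` asserts that the hook-up probability is asymptotically a function of the BIG blobs.
The same verdict applies verbatim to `ZNodeAbsBoundB` of stub S12.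

**A canonical family for `𝔅` (structural handle, not formalised).**  On `TPinch ∩ THook ∖ THookBig` let `D` be the open
cluster of the crossing `O₁` in `bigRoute` (interior sites and big inner-touching blobs) and `U` the open cluster of `O₂` in the
open sites off `D`.  `D` can only be left through an interior site into a SMALL inner-touching blob, so the set `J` of small
blobs of `U` adjacent to `D` is nonempty, intrinsic (no minimality, no choice), every `β ∈ J` is two-sided (`D` and `U` both
reach the outer layer), and every `J`-free annulus around a `J`-blob carries `TFourArmTwoClusters` honestly (a connection inside
the annulus would leave `D` through another `J`-blob).  `J` has the node property of `covering_B` with `F := J`; its dense runs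
are the interlocking combs of `D` and `U` along the sphere `|· - x|_𝕋 = s` (contacts are interior, `NeckCoarse.contact_mem_tBall`),
and `P(|J ∩ window| ≥ m)` is the canonical quantity a future necklace estimate should address.
-/

noncomputable section

namespace Summit.CriticalPhenomena.CardyFormulaZ2.Cruxes.NestingRigidity.PinchResampling

open MeasureTheory Set Literature.Probability.Percolation Literature.Probability.LatticeModels
open scoped symmDiff

/-! ## §1 The node events and the error decomposition -/

/-- **Necklace node event for `𝔄` on `𝕋`**: two open crossings `b, b'` of the collar not joined by an open path of
`Λ_{2s}(x)`, a nonempty finite family `F ⊆ vEdges` of virtual edges with the node property of `covering_A_nodes`, the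
three-edge exclusion, and a rank with inner/outer endpoints along which the open clusters of `Λ_{2s}(x)` form a necklace of
pairwise distinct clusters (verbatim the conclusion of `tCovering_A_chain`). -/
def TNodeEventChainA (ℓ lam s : ℕ) (x o : Site 2) : Set (SiteConfig (Site 2)) :=
  {η | ∃ (b b' : Site 2) (F : Finset (Site 2 × Site 2)),
    IsCrossing triGraph (tColourGraph η true) (tBall x s) (tBall x (2 * s)) b ∧
    IsCrossing triGraph (tColourGraph η true) (tBall x s) (tBall x (2 * s)) b' ∧
    ¬ PathIn (tColourGraph η true) (tBall x (2 * s)) b b' ∧ ↑F ⊆ vEdges ℓ lam s x o η ∧ F.Nonempty ∧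
    (∀ 𝒩 ⊆ F, 𝒩.Nonempty → ∀ (w : Site 2) (Δ r R Γ : ℕ), w ∈ innerLayer triGraph (tBall x s) (tBall x (2 * s)) →
      (∀ e ∈ 𝒩, triNorm (e.2 - w) ≤ Δ) → (∀ e ∈ F, e ∉ 𝒩 → (Γ : ℤ) ≤ triNorm (e.2 - w)) →
      Δ + 2 * ℓ + 2 ≤ r → r ≤ R → R + 2 * ℓ + 2 ≤ Γ → R + 2 ≤ s →
      ∃ p₁ q₁ p₂ q₂ : Site 2, triNorm (p₁ - w) = r ∧ triNorm (q₁ - w) = R ∧ triNorm (p₂ - w) = r ∧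
        triNorm (q₂ - w) = R ∧ PathIn (tColourGraph η true) (tAnn w r R) p₁ q₁ ∧
        PathIn (tColourGraph η true) (tAnn w r R) p₂ q₂ ∧ ¬ PathIn (tColourGraph η true) (tAnn w r R) p₁ p₂) ∧
    (∀ e₁ ∈ F, ∀ e₂ ∈ F, ∀ e₃ ∈ F, e₁ ≠ e₂ → e₂ ≠ e₃ → e₁ ≠ e₃ →
      ¬ (PathIn (tColourGraph η true) (tBall x (2 * s)) e₁.2 e₂.2 ∧
        PathIn (tColourGraph η true) (tBall x (2 * s)) e₂.2 e₃.2)) ∧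
    ∃ (rk : Site 2 × Site 2 → ℕ) (inP outP : Site 2 × Site 2 → Site 2), Set.InjOn rk ↑F ∧
      (∀ e ∈ F, (inP e, outP e) = e ∨ (outP e, inP e) = e) ∧
      (∀ e ∈ F, (∀ e' ∈ F, rk e ≤ rk e') → PathIn (tColourGraph η true) (tBall x (2 * s)) b (inP e)) ∧
      (∀ e ∈ F, (∀ e' ∈ F, rk e' ≤ rk e) → PathIn (tColourGraph η true) (tBall x (2 * s)) (outP e) b') ∧
      (∀ e ∈ F, ∀ e' ∈ F, rk e < rk e' → (∀ e'' ∈ F, rk e'' ≤ rk e ∨ rk e' ≤ rk e'') →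
        PathIn (tColourGraph η true) (tBall x (2 * s)) (outP e) (inP e')) ∧
      (∀ e ∈ F, ¬ PathIn (tColourGraph η true) (tBall x (2 * s)) b (outP e)) ∧
      (∀ e ∈ F, ∀ e' ∈ F, rk e < rk e' → ¬ PathIn (tColourGraph η true) (tBall x (2 * s)) (outP e) (outP e'))}

/-- **Node event for `𝔅` on `𝕋`**: a nonempty finite family `F` of open inner-layer sites of SMALL blobs (`𝕋`-diameter
`< lam`), distinct members in distinct blobs, two open crossings `v, v'` not joined in `avoidSet s x η F` with every family blob
adjacent to both sides, and the node property of `covering_B_nodes` (verbatim the conclusion of `covering_B_distinct`). -/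
def TNodeEventB (lam s : ℕ) (x : Site 2) : Set (SiteConfig (Site 2)) :=
  {η | ∃ F : Finset (Site 2), (∀ c ∈ F, c ∈ η ∧ c ∈ innerLayer triGraph (tBall x s) (tBall x (2 * s)) ∧
      ¬ ∃ w ∈ blobOf (tColourGraph η true) (tBall x (2 * s) \ tBall x s) c,
        ∃ w' ∈ blobOf (tColourGraph η true) (tBall x (2 * s) \ tBall x s) c, (lam : ℤ) ≤ triNorm (w - w')) ∧
    F.Nonempty ∧
    (∀ c ∈ F, ∀ c' ∈ F, c ≠ c' → c' ∉ blobOf (tColourGraph η true) (tBall x (2 * s) \ tBall x s) c) ∧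
    (∃ v v' : Site 2, IsCrossing triGraph (tColourGraph η true) (tBall x s) (tBall x (2 * s)) v ∧
      IsCrossing triGraph (tColourGraph η true) (tBall x s) (tBall x (2 * s)) v' ∧
      ¬ PathIn (tColourGraph η true) (avoidSet s x η ↑F) v v' ∧
      ∀ c ∈ F, ∃ a₁ c₁ a₂ c₂ : Site 2, PathIn (tColourGraph η true) (avoidSet s x η ↑F) v a₁ ∧
        (tColourGraph η true).Adj a₁ c₁ ∧ c₁ ∈ blobOf (tColourGraph η true) (tBall x (2 * s) \ tBall x s) c ∧
        PathIn (tColourGraph η true) (avoidSet s x η ↑F) v' a₂ ∧ (tColourGraph η true).Adj a₂ c₂ ∧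
        c₂ ∈ blobOf (tColourGraph η true) (tBall x (2 * s) \ tBall x s) c) ∧
    ∀ 𝒩 ⊆ F, 𝒩.Nonempty → ∀ (w : Site 2) (Δ r R Γ : ℕ), w ∈ innerLayer triGraph (tBall x s) (tBall x (2 * s)) →
      (∀ c ∈ 𝒩, triNorm (c - w) ≤ Δ) → (∀ c ∈ F, c ∉ 𝒩 → (Γ : ℤ) ≤ triNorm (c - w)) →
      Δ + lam + 1 ≤ r → r ≤ R → R + lam ≤ Γ → R + 2 ≤ s →
      ∃ p₁ q₁ p₂ q₂ : Site 2, triNorm (p₁ - w) = r ∧ triNorm (q₁ - w) = R ∧ triNorm (p₂ - w) = r ∧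
        triNorm (q₂ - w) = R ∧ PathIn (tColourGraph η true) (tAnn w r R) p₁ q₁ ∧
        PathIn (tColourGraph η true) (tAnn w r R) p₂ q₂ ∧ ¬ PathIn (tColourGraph η true) (tAnn w r R) p₁ p₂}

/-- **The `𝔄`-error lies in the necklace node event** (`1 ≤ ℓ`, `1 ≤ lam`, `lam + 1 ≤ s`). -/
theorem diff_tHookStar_tHook_subset {ℓ lam s : ℕ} (x o : Site 2) (hℓ : 1 ≤ ℓ) (hlam : 1 ≤ lam) (hls : lam + 1 ≤ s) :
    THookStar ℓ lam s x o \ THook x x s s ⊆ TNodeEventChainA ℓ lam s x o := by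
  rintro η ⟨hS, hnH⟩
  obtain ⟨b, b', F, hb, hb', hnR, hF, hne, hnode, hexcl, rk, inP, outP, hchain⟩ :=
    tCovering_A_chain ℓ lam s x o η hℓ hlam hls hS hnH
  exact ⟨b, b', F, hb, hb', hnR, hF, hne, hnode, hexcl, rk, inP, outP, hchain⟩

/-- **The `𝔅`-error lies in the node event for `𝔅`** (`1 ≤ lam`, `lam + 1 ≤ s`). -/
theorem diff_tHook_tHookBig_subset {lam s : ℕ} (x : Site 2) (hlam : 1 ≤ lam) (hls : lam + 1 ≤ s) :
    THook x x s s \ THookBig lam s x ⊆ TNodeEventB lam s x := by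
  rintro η ⟨hH, hnB⟩
  obtain ⟨F, hF, hne, hdist, hside, hnode⟩ := covering_B_distinct hlam hls hH hnB
  exact ⟨F, hF, hne, hdist, hside, hnode⟩

/-- **The error decomposition on `𝕋`**: for `1 ≤ ℓ`, `1 ≤ lam`, `lam + 1 ≤ s`, the two honest error events of the fuzzy
hook-up are covered by the two node events. -/
theorem error_subset_tNodeEvents {ℓ lam s : ℕ} (x o : Site 2) (hℓ : 1 ≤ ℓ) (hlam : 1 ≤ lam) (hls : lam + 1 ≤ s) :
    (THookStar ℓ lam s x o \ THook x x s s) ∪ (THook x x s s \ THookBig lam s x) ⊆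
      TNodeEventChainA ℓ lam s x o ∪ TNodeEventB lam s x :=
  union_subset_union (diff_tHookStar_tHook_subset x o hℓ hlam hls) (diff_tHook_tHookBig_subset x hlam hls)

/-! ## §2 S11 from the two absolute node bounds -/

/-- **Absolute necklace bound for `𝔄` on `𝕋`** (a statement, NOT asserted; the `𝕋` twin of `ZNodeAbsBoundChainA`): in the
window `1 ≤ ℓ`, `s³ℓ ≤ lam⁴`, `L·lam ≤ s` the necklace node event has probability `≤ β`.  Content: the multi-scale summation
of the plan of `…NeckZ2NodeReimerSpatial` over the structure of `TNodeEventChainA`, given (I4T) `FourArmTwoClustersBoundT`. -/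
def TNodeAbsBoundChainA : Prop :=
  ∀ β : ℝ, 0 < β → ∃ L : ℕ, ∀ (x o : Site 2) (ℓ lam s : ℕ), 1 ≤ ℓ → s ^ 3 * ℓ ≤ lam ^ 4 → L * lam ≤ s →
    (triSitePercolation half).real (TNodeEventChainA ℓ lam s x o) ≤ β

/-- **Absolute node bound for `𝔅` on `𝕋`** (a statement, NOT asserted; the `𝕋` twin of `ZNodeAbsBoundB`): for `1 ≤ lam`
and `L·lam ≤ s` the node event for `𝔅` has probability `≤ β`.  Content: the base-scale-`lam` summation plus a per-member
cost for dense runs of two-sided small blobs (see the module docstring: OPEN, both as to proof and as to design). -/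
def TNodeAbsBoundB : Prop :=
  ∀ β : ℝ, 0 < β → ∃ L : ℕ, ∀ (x : Site 2) (lam s : ℕ), 1 ≤ lam → L * lam ≤ s →
    (triSitePercolation half).real (TNodeEventB lam s x) ≤ β

/-- **Small-blob irrelevance on the pinch event** (a statement, NOT asserted; the honest `𝔅`-input of S11, implied by
`TNodeAbsBoundB`): for `1 ≤ lam` and `L·lam ≤ s`, with probability `≤ β` the pinch event occurs together with a hook-up that is
NOT a hook-up through interior sites and big blobs. -/
def TSmallBlobIrrelevanceT : Prop :=
  ∀ β : ℝ, 0 < β → ∃ L : ℕ, ∀ (x : Site 2) (lam s : ℕ), 1 ≤ lam → L * lam ≤ s →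
    (triSitePercolation half).real (TPinch x x s s ∩ (THook x x s s \ THookBig lam s x)) ≤ β

/-- The absolute node bound for `𝔅` implies small-blob irrelevance (`THook ∖ THookBig ⊆ TNodeEventB` for `lam + 1 ≤ s`; for
`s ≤ lam` there is no small-blob hook-up at all unless `s = 0`, where the pinch event is empty — we simply take `L ≥ 2`). -/
theorem tSmallBlobIrrelevance_of_nodeBoundB (hB : TNodeAbsBoundB) : TSmallBlobIrrelevanceT := by
  intro β hβ
  obtain ⟨L, hL⟩ := hB β hβ
  refine ⟨max L 2, fun x lam s hlam hLs ↦ ?_⟩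
  have hLs' : L * lam ≤ s := le_trans (Nat.mul_le_mul_right lam (le_max_left _ _)) hLs
  have h2s : 2 * lam ≤ s := le_trans (Nat.mul_le_mul_right lam (le_max_right _ _)) hLs
  have hls : lam + 1 ≤ s := by omega
  calc (triSitePercolation half).real (TPinch x x s s ∩ (THook x x s s \ THookBig lam s x))
      ≤ (triSitePercolation half).real (TNodeEventB lam s x) :=
        measureReal_mono (fun η hη ↦ diff_tHook_tHookBig_subset x hlam hls hη.2) (measure_ne_top _ _)
    _ ≤ β := hL x lam s hlam hLs'

/-- For radius `0` the collar is empty and the selection event is empty. -/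
theorem NeckCoarse.tPinch_zero (x : Site 2) : TPinch x x 0 0 = ∅ := by
  refine Set.subset_empty_iff.1 ?_
  rintro ω ⟨⟨⟨v₁, -, ⟨⟨hvOI, -⟩, -⟩, -⟩, -⟩, -⟩
  have h1 : v₁ ∈ tBall x 0 := by simpa using hvOI.1
  exact hvOI.2 h1

/-- **The summation hypothesis of `hookStarApproxT_of_absolute` from the absolute necklace bound for `𝔄` and small-blob
irrelevance.** -/
theorem tErrorAbs_of_chainA_of_irrelevance (hA : TNodeAbsBoundChainA) (hB : TSmallBlobIrrelevanceT) : ∀ β : ℝ, 0 < β → ∃ L : ℕ, ∀ (x o : Site 2) (ℓ lam s : ℕ), 1 ≤ ℓ → s ^ 3 * ℓ ≤ lam ^ 4 → L * lam ≤ s → (triSitePercolation half).real (TPinch x x s s ∩ ((THookStar ℓ lam s x o \ THook x x s s) ∪ (THook x x s s \ THookBig lam s x))) ≤ β := by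
  intro β hβ
  obtain ⟨L₁, hL₁⟩ := hA (β / 2) (by positivity)
  obtain ⟨L₂, hL₂⟩ := hB (β / 2) (by positivity)
  refine ⟨max (max L₁ L₂) 2, fun x o ℓ lam s hℓ hw hLs ↦ ?_⟩
  set μ := triSitePercolation half with hμ
  have hL₁s : L₁ * lam ≤ s := le_trans (Nat.mul_le_mul_right lam ((le_max_left _ _).trans (le_max_left _ _))) hLs
  have hL₂s : L₂ * lam ≤ s := le_trans (Nat.mul_le_mul_right lam ((le_max_right _ _).trans (le_max_left _ _))) hLs
  have h2s : 2 * lam ≤ s := le_trans (Nat.mul_le_mul_right lam (le_max_right _ _)) hLs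
  rcases Nat.eq_zero_or_pos s with rfl | hs
  · -- `s = 0`: the selection event is empty
    rw [NeckCoarse.tPinch_zero, Set.empty_inter, measureReal_empty]
    exact hβ.le
  · -- `1 ≤ s` forces `1 ≤ lam` in the window, whence `lam + 1 ≤ s`
    have hlam : 1 ≤ lam := by
      by_contra hl
      have hl0 : lam = 0 := by omega
      subst hl0
      have : 1 ≤ s ^ 3 * ℓ := Nat.one_le_iff_ne_zero.2 (by positivity)
      simp at hw
      omega
    have hls : lam + 1 ≤ s := by omega
    calc μ.real (TPinch x x s s ∩ ((THookStar ℓ lam s x o \ THook x x s s) ∪ (THook x x s s \ THookBig lam s x)))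
        ≤ μ.real (TNodeEventChainA ℓ lam s x o ∪ TPinch x x s s ∩ (THook x x s s \ THookBig lam s x)) := by
          refine measureReal_mono (fun η hη ↦ ?_) (measure_ne_top _ _)
          rcases hη.2 with h | h
          · exact Or.inl (diff_tHookStar_tHook_subset x o hℓ hlam hls h)
          · exact Or.inr ⟨hη.1, h⟩
      _ ≤ μ.real (TNodeEventChainA ℓ lam s x o) + μ.real (TPinch x x s s ∩ (THook x x s s \ THookBig lam s x)) :=
          measureReal_union_le _ _
      _ ≤ β / 2 + β / 2 := add_le_add (hL₁ x o ℓ lam s hℓ hw hL₁s) (hL₂ x lam s hlam hL₂s)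
      _ = β := by ring

/-- **The summation hypothesis of `hookStarApproxT_of_absolute` from the two absolute node bounds.** -/
theorem tErrorAbs_of_nodeBounds (hA : TNodeAbsBoundChainA) (hB : TNodeAbsBoundB) : ∀ β : ℝ, 0 < β → ∃ L : ℕ, ∀ (x o : Site 2) (ℓ lam s : ℕ), 1 ≤ ℓ → s ^ 3 * ℓ ≤ lam ^ 4 → L * lam ≤ s → (triSitePercolation half).real (TPinch x x s s ∩ ((THookStar ℓ lam s x o \ THook x x s s) ∪ (THook x x s s \ THookBig lam s x))) ≤ β :=
  tErrorAbs_of_chainA_of_irrelevance hA (tSmallBlobIrrelevance_of_nodeBoundB hB)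

/-- **`HookStarApproxT` from the absolute necklace bound for `𝔄` and small-blob irrelevance** (with the tree's positivity
`tPinchPositive_holds`). -/
theorem hookStarApproxT_of_chainA_of_irrelevance (hA : TNodeAbsBoundChainA) (hB : TSmallBlobIrrelevanceT) :
    HookStarApproxT :=
  hookStarApproxT_of_absolute tPinchPositive_holds (tErrorAbs_of_chainA_of_irrelevance hA hB)

/-- **Stub S11 from the absolute necklace bound for `𝔄` and small-blob irrelevance** (the weakest pair of inputs isolated
here). -/
theorem neckHookupCoarseT_of_chainA_of_irrelevance (hA : TNodeAbsBoundChainA) (hB : TSmallBlobIrrelevanceT) :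
    NeckHookupCoarseT :=
  neckHookupCoarseT_of_hookStarApproxT (hookStarApproxT_of_chainA_of_irrelevance hA hB)

/-- **`HookStarApproxT` from the two absolute node bounds** (with the tree's positivity `tPinchPositive_holds`). -/
theorem hookStarApproxT_of_nodeBounds (hA : TNodeAbsBoundChainA) (hB : TNodeAbsBoundB) : HookStarApproxT :=
  hookStarApproxT_of_absolute tPinchPositive_holds (tErrorAbs_of_nodeBounds hA hB)

/-- **Stub S11 from the two absolute node bounds (registered helper, anchor of this module on the crux item)** — the exact
remaining inputs of `stub_neckHookupCoarseT` after wave 6: the absolute necklace bound `TNodeAbsBoundChainA` for the `𝔄`-error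
and the absolute bound `TNodeAbsBoundB` for the `𝔅`-error (positivity (I0) is the theorem `tPinchPositive_holds`; the
reductions `hookStarApproxT_of_absolute`, `neckHookupCoarseT_of_hookStarApproxT` are in `…NeckHookStarTarget`). -/
theorem neckHookupCoarseT_of_nodeInputs : TNodeAbsBoundChainA → TNodeAbsBoundB → NeckHookupCoarseT :=
  fun hA hB ↦ neckHookupCoarseT_of_hookStarApproxT (hookStarApproxT_of_nodeBounds hA hB)

end Summit.CriticalPhenomena.CardyFormulaZ2.Cruxes.NestingRigidity.PinchResampling

end
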